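import Summits.CriticalPhenomena.PercolationContinuityZ3.Theorems.PercNearOneGluingNoHeavyQuantConvHeavy
import Summits.CriticalPhenomena.PercolationContinuityZ3.Theorems.PercNearOneGluingNoHeavyQuantFlowUncross
import HarnessLib

/-!
# QUANT lane R8, T-DEC: a first CLOSED sub-family of the two-sided residue `ConvClosedTResidue` — single-head factors with deep lows, no low cross cell,
# floor `x ≥ 1/2` — by the giant pool (criterion E) and the structure fact "the head of such a factor carries at least `x`"

builds on p205010 (kernel theorem, internal audit signed; external expert review pending)

Support file (`--supports stmt-CriticalPhenomena-4575`), QUANT lane seat prim-quant-census-1 (gen 21), rung R8 of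
`run/shared/lean/prim/quant/LADDER.md`.  Memo `run/shared/lean/prim/quant/prim-quant-census-1/CONV-RESIDUE-G21.md` §2.  Theorems only, standard axioms,
no sorries.  Companion of `…QuantConvTopDatum` (this seat): that file reduces the residue to a light-slice lemma; this one settles outright the part of the
residue that the GIANT POOL covers (memo §2: 51 954 / 55 727 of the censused atom pairs at floors `x ≥ 1/2`), in the cleanest sub-family.

THE FAMILY.  Floor `1/2 ≤ x < 1`; `μ₁` a probability law on `{0..M₁}` with a HEAD `h₁ ≤ M₁` and all its other charged positions DEEP LOWS (`k ≤ j − M₂`,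
`2k < T₁`); `μ₂` likewise with head `h₂ ≤ M₂` (deep lows `k ≤ j − M₁`, `2k < T₂`); the head cell is a giant of the convolution (`j < h₁ + h₂`); the CROSS cells
`h₁ + q`, `i + h₂` (`q`, `i` charged non-head positions) that lie at or below the layer are not lows of the convolution (`T₁ + T₂ ≤ 2(h₁ + q)`,
`T₁ + T₂ ≤ 2(i + h₂)`); and each factor is DEC at its target at the BOTTOM layer of its window (`μ₁` at `j − M₂`, `μ₂` at `j − M₁`).  Then
`lconv M₁ M₂ μ₁ μ₂ ∈ D(T₁ + T₂, j)`.  This contains every residue pair of census-2 g56's shapes LLA ⊗ LLA (matched tops `h_i = M_i`, both lows of each atom at or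
below the other's bottom layer) with no low cross cell at floors `≥ 1/2` — e.g. 147 + 28 + 26 + 17 + … of the 251 `x ≥ 1/2` LLA ⊗ LLA pairs of memo CONV-G20/e5.

THE PROOF.  (1) `LawDec.tails_le_head_of_decAtT`: at a layer `J` where a law's charged positions are lows `≤ J` and ONE giant `h > J`, weak duality
(`dual_le_of_decAtT`, typer g22) with the price `x/(1−x)` on the lows gives `(x/(1−x))·(1 − μ h) ≤ μ h`, i.e. `μ h ≥ x` (`head_ge_floor_of_decAtT`).
(2) `LawDec.sum_low_lconv_le`: the lows of the convolution lie in (non-head) ⊗ (non-head), so their mass is `≤ (1 − μ₁ h₁)(1 − μ₂ h₂)`; the giants contain the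
head cell, mass `≥ μ₁ h₁ · μ₂ h₂` (`lconv_headCell_le_giants`).  (3) With `μ_i h_i ≥ x ≥ 1/2`: `x(1 − μ₁ h₁)(1 − μ₂ h₂) ≤ x(1−x)² ≤ (1−x)x² ≤ (1−x)μ₁ h₁ μ₂ h₂`,
which is criterion E for the convolution (`hflowAtT_of_giantsAbsorbLows` + `hdecAtT_of_hflowAtT`, typer g22).

* `LawDec.tails_le_head_of_decAtT`, `LawDec.head_ge_floor_of_decAtT` — structure of a one-head law at a giant-mode layer.
* `LawDec.sum_low_lconv_le`, `LawDec.lconv_headCell_le_giants` — bookkeeping of the convolution's lows and giants.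
* **`LawDec.lconv_decAtT_oneHead_giantPool`** — the sub-family theorem.
HONEST: `ConvClosedTResidue`, `ConvClosedTSmall`, `ConvClosedT` remain OPEN (this is the giant-pool corner of the residue; the light-slice lemma LS of memo §4 is
the open core); RATE class log\* / honest sentence unchanged.

[this work]; memo CONV-RESIDUE-G21 (census-1), CONV-ATOMS-G56 (census-2) (this lane).  Nothing here is cited as a published result.  The gluing rows served
[cite: KozmaNitzan2024, Conjecture 3 (p. 15)]; product measure [cite: Grimmett1999, §1.3 p. 10].
-/

noncomputable section

namespace Summit.CriticalPhenomena.PercolationContinuityZ3.Theorems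

namespace Quant

open Finset

namespace LawDec

/-! ### (1) A one-head law at a giant-mode layer: the head carries at least `x` -/

/-- **TAILS VS HEAD AT A GIANT-MODE LAYER.**  `0 < x < 1`, `μ` on `{0..M}` DEC(J) at target `T`; every charged position other than `h` is a low of
layer `J` (`k ≤ J`, `2k < T`) and `J < h ≤ M`.  Then `(x/(1−x))·Σ_{k ≤ M, k ≠ h} μ k ≤ μ h`: weak duality (`dual_le_of_decAtT`) with price `x/(1−x)` on every
low and `1` on the giants — the mids `≤ J` are uncharged and may be priced as high as needed. [this work] -/
theorem tails_le_head_of_decAtT (x T : ℝ) (J M h : ℕ) (μ : ℕ → ℝ) (hx0 : 0 < x) (hx1 : x < 1)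
    (hdec : DECAtT x T J M μ) (hJh : J + 1 ≤ h) (hhM : h ≤ M)
    (htail : ∀ k, μ k ≠ 0 → k ≠ h → k ≤ J ∧ 2 * (k : ℝ) < T) :
    x / (1 - x) * ∑ k ∈ Finset.range (M + 1), (if k = h then 0 else μ k) ≤ μ h := by
  classical
  set u : ℝ := x / (1 - x) with hu
  have hu0 : 0 < u := div_pos hx0 (by linarith)
  -- prices: `u` on lows; `1` on giants; on a mid `k ≤ J` the sum of `u/usage` over its compatible lows (it is uncharged anyway)
  set β : ℕ → ℝ := fun k => if J + 1 ≤ k then 1 else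
    u * ∑ l ∈ Finset.range (J + 1), (if 2 * (l : ℝ) < T ∧ T < (l : ℝ) + k then 1 / usage x T J l k else 0) with hβ
  have hβ0 : ∀ k, 0 ≤ β k := by
    intro k; simp only [hβ]
    split_ifs
    · exact zero_le_one
    · refine mul_nonneg hu0.le (Finset.sum_nonneg fun l _ => ?_)
      split_ifs with hc
      · have hlk : l < k := by
          have : (l : ℝ) < k := by linarith [hc.1, hc.2]
          exact_mod_cast this
        exact (one_div_pos.2 (usage_pos_of_compat x T J l k hx0 hx1 hc.1 hlk (Or.inr hc.2))).le
      · exact le_rfl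
  have hαβ : ∀ l k, l ≤ J → 2 * (l : ℝ) < T → k ≤ M → (J + 1 ≤ k ∨ T < (l : ℝ) + k) → u ≤ usage x T J l k * β k := by
    intro l k hlJ hlow hkM hc
    simp only [hβ]
    by_cases hgk : J + 1 ≤ k
    · rw [if_pos hgk, usage_giant_eq x T J l k hgk, mul_one]
    · rw [if_neg hgk]
      have hck : T < (l : ℝ) + k := by
        rcases hc with h1 | h1
        · exact absurd h1 hgk
        · exact h1
      have hlk : l < k := by
        have : (l : ℝ) < k := by linarith
        exact_mod_cast this
      have hU := usage_pos_of_compat x T J l k hx0 hx1 hlow hlk (Or.inr hck)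
      have hterm : 1 / usage x T J l k ≤
          ∑ l' ∈ Finset.range (J + 1), (if 2 * (l' : ℝ) < T ∧ T < (l' : ℝ) + k then 1 / usage x T J l' k else 0) := by
        have hmem : l ∈ Finset.range (J + 1) := Finset.mem_range.2 (Nat.lt_succ_of_le hlJ)
        refine le_trans (le_of_eq ?_) (Finset.single_le_sum (f := fun (l' : ℕ) =>
          (if 2 * (l' : ℝ) < T ∧ T < (l' : ℝ) + k then 1 / usage x T J l' k else 0)) (fun l' _ => ?_) hmem)
        · rw [if_pos ⟨hlow, hck⟩]
        · split_ifs with hc'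
          · have hlk' : l' < k := by
              have : (l' : ℝ) < k := by linarith [hc'.1, hc'.2]
              exact_mod_cast this
            exact (one_div_pos.2 (usage_pos_of_compat x T J l' k hx0 hx1 hc'.1 hlk' (Or.inr hc'.2))).le
          · exact le_rfl
      calc u = usage x T J l k * (u * (1 / usage x T J l k)) := by field_simp
        _ ≤ usage x T J l k * (u * ∑ l' ∈ Finset.range (J + 1),
              (if 2 * (l' : ℝ) < T ∧ T < (l' : ℝ) + k then 1 / usage x T J l' k else 0)) :=
            mul_le_mul_of_nonneg_left (mul_le_mul_of_nonneg_left hterm hu0.le) hU.le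
  have wd := dual_le_of_decAtT x T J M μ hx0 hx1 hdec (fun _ => u) β hβ0 hαβ
  -- left side: every charged `k ≠ h` is a low `≤ J`, so the low sum is the tail sum
  have hL : u * ∑ k ∈ Finset.range (M + 1), (if k = h then 0 else μ k)
      = ∑ l ∈ Finset.range (J + 1), (if 2 * (l : ℝ) < T then u * μ l else 0) := by
    rw [Finset.mul_sum]
    have hJM : J + 1 ≤ M + 1 := by omega
    rw [← Finset.sum_range_add_sum_Ico _ hJM]
    have hz : ∑ k ∈ Finset.Ico (J + 1) (M + 1), u * (if k = h then 0 else μ k) = 0 := by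
      refine Finset.sum_eq_zero fun k hk => ?_
      rw [Finset.mem_Ico] at hk
      by_cases hkh : k = h
      · rw [if_pos hkh, mul_zero]
      · rw [if_neg hkh]
        by_cases hμ : μ k = 0
        · rw [hμ, mul_zero]
        · exfalso; have := (htail k hμ hkh).1; omega
    rw [hz, add_zero]
    refine Finset.sum_congr rfl fun l hl => ?_
    have hlJ : l ≤ J := Nat.lt_succ_iff.1 (Finset.mem_range.1 hl)
    have hlh : l ≠ h := by omega
    rw [if_neg hlh]
    by_cases hlow : 2 * (l : ℝ) < T
    · rw [if_pos hlow]
    · rw [if_neg hlow]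
      by_cases hμ : μ l = 0
      · rw [hμ, mul_zero]
      · exact absurd (htail l hμ hlh).2 hlow
  -- right side: only the giant `h` is charged among the absorbers
  have hR : ∑ k ∈ Finset.range (M + 1), (if k ≤ J ∧ 2 * (k : ℝ) < T then 0 else β k * μ k) ≤ μ h := by
    have hsplit : ∑ k ∈ Finset.range (M + 1), (if k ≤ J ∧ 2 * (k : ℝ) < T then 0 else β k * μ k)
        = ∑ k ∈ Finset.range (M + 1), (if k = h then μ h else 0) := by
      refine Finset.sum_congr rfl fun k hk => ?_
      by_cases hkh : k = h
      · subst hkh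
        have h1 : ¬ (k ≤ J ∧ 2 * (k : ℝ) < T) := fun hc => by omega
        rw [if_neg h1, if_pos rfl]
        simp only [hβ]; rw [if_pos hJh, one_mul]
      · rw [if_neg hkh]
        split_ifs with h1
        · rfl
        · by_cases hμ : μ k = 0
          · rw [hμ, mul_zero]
          · exact absurd (htail k hμ hkh) (fun hc => h1 ⟨hc.1, hc.2⟩)
    rw [hsplit, Finset.sum_ite_eq' (Finset.range (M + 1)) h, if_pos (Finset.mem_range.2 (Nat.lt_succ_of_le hhM))]
  rw [hL]
  exact wd.trans hR

/-- **hence the head carries at least the floor**: with total mass `1`, `(x/(1−x))(1 − μ h) ≤ μ h`, i.e. `x ≤ μ h`. [this work] -/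
theorem head_ge_floor_of_decAtT (x T : ℝ) (J M h : ℕ) (μ : ℕ → ℝ) (hx0 : 0 < x) (hx1 : x < 1) (hμ0 : ∀ k, 0 ≤ μ k)
    (hμ1 : ∑ k ∈ Finset.range (M + 1), μ k = 1)
    (hdec : DECAtT x T J M μ) (hJh : J + 1 ≤ h) (hhM : h ≤ M)
    (htail : ∀ k, μ k ≠ 0 → k ≠ h → k ≤ J ∧ 2 * (k : ℝ) < T) :
    x ≤ μ h := by
  have ht := tails_le_head_of_decAtT x T J M h μ hx0 hx1 hdec hJh hhM htail
  have hsum : ∑ k ∈ Finset.range (M + 1), (if k = h then 0 else μ k) = 1 - μ h := by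
    have e : ∀ k ∈ Finset.range (M + 1), (if k = h then (0 : ℝ) else μ k) = μ k - (if k = h then μ k else 0) := by
      intro k _; split_ifs with hk
      · rw [hk]; ring
      · ring
    rw [Finset.sum_congr rfl e, Finset.sum_sub_distrib, hμ1, Finset.sum_ite_eq' (Finset.range (M + 1)) h,
      if_pos (Finset.mem_range.2 (Nat.lt_succ_of_le hhM))]
  rw [hsum] at ht
  have h1x : 0 < 1 - x := by linarith
  rw [div_mul_eq_mul_div, div_le_iff₀ h1x] at ht
  have hμh1 : μ h ≤ 1 := by
    rw [← hμ1]
    exact Finset.single_le_sum (f := μ) (fun k _ => hμ0 k) (Finset.mem_range.2 (Nat.lt_succ_of_le hhM))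
  nlinarith

/-! ### (2) Bookkeeping of the convolution's lows and giants -/

/-- **the convolution's lows lie in (non-head) ⊗ (non-head)**: if every cell `(i, q)` with `i + q ≤ j`, `2(i+q) < T` and `i = h₁ ∨ q = h₂` is uncharged
(`μ₁ i · μ₂ q = 0`), then `Σ_{k ≤ j, 2k < T} lconv k ≤ (Σ_{i ≠ h₁} μ₁ i)·(Σ_{q ≠ h₂} μ₂ q)` (`μ₁, μ₂ ≥ 0`). [this work] -/
theorem sum_low_lconv_le (T : ℝ) (j M₁ M₂ h₁ h₂ : ℕ) (μ₁ μ₂ : ℕ → ℝ) (h10 : ∀ k, 0 ≤ μ₁ k) (h20 : ∀ k, 0 ≤ μ₂ k)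
    (hcell : ∀ i q, i + q ≤ j → 2 * ((i + q : ℕ) : ℝ) < T → (i = h₁ ∨ q = h₂) → μ₁ i * μ₂ q = 0) :
    ∑ k ∈ Finset.range (j + 1), (if 2 * (k : ℝ) < T then lconv M₁ M₂ μ₁ μ₂ k else 0)
      ≤ (∑ i ∈ Finset.range (M₁ + 1), (if i = h₁ then 0 else μ₁ i)) * (∑ q ∈ Finset.range (M₂ + 1), (if q = h₂ then 0 else μ₂ q)) := by
  classical
  -- push the low indicator inside the double sum and swap
  have e1 : ∀ k ∈ Finset.range (j + 1), (if 2 * (k : ℝ) < T then lconv M₁ M₂ μ₁ μ₂ k else 0)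
      = ∑ i ∈ Finset.range (M₁ + 1), ∑ q ∈ Finset.range (M₂ + 1),
          (if 2 * (k : ℝ) < T ∧ i + q = k then μ₁ i * μ₂ q else 0) := by
    intro k _
    by_cases hk : 2 * (k : ℝ) < T
    · rw [if_pos hk]; simp only [lconv]
      refine Finset.sum_congr rfl fun i _ => Finset.sum_congr rfl fun q _ => ?_
      by_cases hiq : i + q = k
      · rw [if_pos hiq, if_pos ⟨hk, hiq⟩]
      · rw [if_neg hiq, if_neg (fun hc => hiq hc.2)]
    · rw [if_neg hk]; symm
      exact Finset.sum_eq_zero fun i _ => Finset.sum_eq_zero fun q _ => by rw [if_neg (fun hc => hk hc.1)]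
  rw [Finset.sum_congr rfl e1, Finset.sum_comm]
  simp_rw [Finset.sum_comm (s := Finset.range (j + 1)) (t := Finset.range (M₂ + 1))]
  -- the inner sum over `k` is the indicator of "cell (i, q) is a low"
  have e2 : ∀ i q, ∑ k ∈ Finset.range (j + 1), (if 2 * (k : ℝ) < T ∧ i + q = k then μ₁ i * μ₂ q else 0)
      = if (i + q ≤ j ∧ 2 * ((i + q : ℕ) : ℝ) < T) then μ₁ i * μ₂ q else 0 := by
    intro i q
    have e3 : ∀ k ∈ Finset.range (j + 1), (if 2 * (k : ℝ) < T ∧ i + q = k then μ₁ i * μ₂ q else 0)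
        = if i + q = k then (if 2 * ((i + q : ℕ) : ℝ) < T then μ₁ i * μ₂ q else 0) else 0 := by
      intro k _
      by_cases hiq : i + q = k
      · subst hiq; rw [if_pos rfl]
        by_cases hk : 2 * ((i + q : ℕ) : ℝ) < T
        · rw [if_pos ⟨hk, rfl⟩, if_pos hk]
        · rw [if_neg (fun hc => hk hc.1), if_neg hk]
      · rw [if_neg hiq, if_neg (fun hc => hiq hc.2)]
    rw [Finset.sum_congr rfl e3, Finset.sum_ite_eq]
    by_cases hm : i + q ∈ Finset.range (j + 1)
    · rw [if_pos hm]
      have hle : i + q ≤ j := Nat.lt_succ_iff.1 (Finset.mem_range.1 hm)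
      by_cases hk : 2 * ((i + q : ℕ) : ℝ) < T
      · rw [if_pos hk, if_pos ⟨hle, hk⟩]
      · rw [if_neg hk, if_neg (fun hc => hk hc.2)]
    · rw [if_neg hm, if_neg (fun hc => hm (Finset.mem_range.2 (Nat.lt_succ_of_le hc.1)))]
  rw [Finset.sum_mul_sum]
  refine Finset.sum_le_sum fun i _ => Finset.sum_le_sum fun q _ => ?_
  rw [e2 i q]
  by_cases hc : i + q ≤ j ∧ 2 * ((i + q : ℕ) : ℝ) < T
  · rw [if_pos hc]
    by_cases hhd : i = h₁ ∨ q = h₂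
    · rw [hcell i q hc.1 hc.2 hhd]
      exact mul_nonneg (by split_ifs <;> [exact le_rfl; exact h10 i]) (by split_ifs <;> [exact le_rfl; exact h20 q])
    · have hhd' : i ≠ h₁ ∧ q ≠ h₂ := not_or.mp hhd
      rw [if_neg hhd'.1, if_neg hhd'.2]
  · rw [if_neg hc]
    exact mul_nonneg (by split_ifs <;> [exact le_rfl; exact h10 i]) (by split_ifs <;> [exact le_rfl; exact h20 q])

/-- **the head cell is a giant cell**: `j < h₁ + h₂ ≤ M₁ + M₂` ⟹ `μ₁ h₁ · μ₂ h₂ ≤ Σ_{j < k ≤ M₁+M₂} lconv k` (`μ₁, μ₂ ≥ 0`). [this work] -/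
theorem lconv_headCell_le_giants (j M₁ M₂ h₁ h₂ : ℕ) (μ₁ μ₂ : ℕ → ℝ) (h10 : ∀ k, 0 ≤ μ₁ k) (h20 : ∀ k, 0 ≤ μ₂ k)
    (hh1 : h₁ ≤ M₁) (hh2 : h₂ ≤ M₂) (hj : j < h₁ + h₂) :
    μ₁ h₁ * μ₂ h₂ ≤ ∑ k ∈ Finset.Ico (j + 1) (M₁ + M₂ + 1), lconv M₁ M₂ μ₁ μ₂ k := by
  classical
  have hmem : h₁ + h₂ ∈ Finset.Ico (j + 1) (M₁ + M₂ + 1) := Finset.mem_Ico.2 ⟨by omega, by omega⟩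
  refine le_trans ?_ (Finset.single_le_sum (f := fun k => lconv M₁ M₂ μ₁ μ₂ k)
    (fun k _ => lconv_nonneg M₁ M₂ μ₁ μ₂ h10 h20 k) hmem)
  -- the cell (h₁, h₂) is one term of the double sum defining `lconv (h₁ + h₂)`
  simp only [lconv]
  refine le_trans ?_ (Finset.single_le_sum (f := fun i => ∑ q ∈ Finset.range (M₂ + 1),
      (if i + q = h₁ + h₂ then μ₁ i * μ₂ q else 0))
    (fun i _ => Finset.sum_nonneg fun q _ => by split_ifs <;> [exact mul_nonneg (h10 i) (h20 q); exact le_rfl])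
    (Finset.mem_range.2 (Nat.lt_succ_of_le hh1)))
  refine le_trans ?_ (Finset.single_le_sum (f := fun q => (if h₁ + q = h₁ + h₂ then μ₁ h₁ * μ₂ q else 0))
    (fun q _ => by split_ifs <;> [exact mul_nonneg (h10 h₁) (h20 q); exact le_rfl])
    (Finset.mem_range.2 (Nat.lt_succ_of_le hh2)))
  rw [if_pos rfl]

/-! ### (3) The sub-family theorem -/

/-- **GIANT-POOL SUB-FAMILY OF THE RESIDUE.**  Floor `1/2 ≤ x < 1`; probability laws `μ₁` on `{0..M₁}`, `μ₂` on `{0..M₂}`; heads `h₁ ≤ M₁`, `h₂ ≤ M₂` with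
`j < h₁ + h₂`, each head a giant at the other window's bottom layer (`j − M₂ < h₁`, `j − M₁ < h₂`; ℕ-subtraction); every other charged position of `μ₁` is a
DEEP LOW (`k ≤ j − M₂`, `2k < T₁`), of `μ₂` likewise (`k ≤ j − M₁`, `2k < T₂`); the cross cells at or
below the layer are not lows of the convolution; `μ₁ ∈ D(T₁, j − M₂)` and `μ₂ ∈ D(T₂, j − M₁)` (the bottom layers of the two windows of `ConvClosedT`).  Then
`lconv M₁ M₂ μ₁ μ₂ ∈ D(T₁ + T₂, j)` — by criterion E: the lows of the convolution have mass `≤ (1 − μ₁ h₁)(1 − μ₂ h₂) ≤ (1−x)²`, its giants `≥ μ₁ h₁ μ₂ h₂ ≥ x²`,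
and `x(1−x)² ≤ (1−x)x²` for `x ≥ 1/2`.  (The laws need not vanish above `Mᵢ` — `lconv` only reads `{0..Mᵢ}`.) [this work] -/
theorem lconv_decAtT_oneHead_giantPool (x T₁ T₂ : ℝ) (j M₁ M₂ h₁ h₂ : ℕ) (μ₁ μ₂ : ℕ → ℝ) (hx : 1 / 2 ≤ x) (hx1 : x < 1)
    (h10 : ∀ k, 0 ≤ μ₁ k) (h11 : ∑ k ∈ Finset.range (M₁ + 1), μ₁ k = 1)
    (h20 : ∀ k, 0 ≤ μ₂ k) (h21 : ∑ k ∈ Finset.range (M₂ + 1), μ₂ k = 1)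
    (hh1 : h₁ ≤ M₁) (hh2 : h₂ ≤ M₂) (hj : j < h₁ + h₂) (hg1 : j - M₂ < h₁) (hg2 : j - M₁ < h₂)
    (htail1 : ∀ k, μ₁ k ≠ 0 → k ≠ h₁ → k ≤ j - M₂ ∧ 2 * (k : ℝ) < T₁)
    (htail2 : ∀ k, μ₂ k ≠ 0 → k ≠ h₂ → k ≤ j - M₁ ∧ 2 * (k : ℝ) < T₂)
    (hcross1 : ∀ q, μ₂ q ≠ 0 → q ≠ h₂ → h₁ + q ≤ j → T₁ + T₂ ≤ 2 * ((h₁ + q : ℕ) : ℝ))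
    (hcross2 : ∀ i, μ₁ i ≠ 0 → i ≠ h₁ → i + h₂ ≤ j → T₁ + T₂ ≤ 2 * ((i + h₂ : ℕ) : ℝ))
    (hdec1 : DECAtT x T₁ (j - M₂) M₁ μ₁) (hdec2 : DECAtT x T₂ (j - M₁) M₂ μ₂) :
    DECAtT x (T₁ + T₂) j (M₁ + M₂) (lconv M₁ M₂ μ₁ μ₂) := by
  classical
  have hx0 : 0 < x := by linarith
  -- (1) heads carry at least x
  have ha1 : x ≤ μ₁ h₁ := head_ge_floor_of_decAtT x T₁ (j - M₂) M₁ h₁ μ₁ hx0 hx1 h10 h11 hdec1 (by omega) hh1 htail1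
  have ha2 : x ≤ μ₂ h₂ := head_ge_floor_of_decAtT x T₂ (j - M₁) M₂ h₂ μ₂ hx0 hx1 h20 h21 hdec2 (by omega) hh2 htail2
  have hb1 : μ₁ h₁ ≤ 1 := by
    rw [← h11]; exact Finset.single_le_sum (f := μ₁) (fun k _ => h10 k) (Finset.mem_range.2 (Nat.lt_succ_of_le hh1))
  have hb2 : μ₂ h₂ ≤ 1 := by
    rw [← h21]; exact Finset.single_le_sum (f := μ₂) (fun k _ => h20 k) (Finset.mem_range.2 (Nat.lt_succ_of_le hh2))
  -- tail sums
  have ht1 : ∑ i ∈ Finset.range (M₁ + 1), (if i = h₁ then 0 else μ₁ i) = 1 - μ₁ h₁ := by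
    have e : ∀ k ∈ Finset.range (M₁ + 1), (if k = h₁ then (0 : ℝ) else μ₁ k) = μ₁ k - (if k = h₁ then μ₁ k else 0) := by
      intro k _; split_ifs with hk
      · rw [hk]; ring
      · ring
    rw [Finset.sum_congr rfl e, Finset.sum_sub_distrib, h11, Finset.sum_ite_eq' (Finset.range (M₁ + 1)) h₁,
      if_pos (Finset.mem_range.2 (Nat.lt_succ_of_le hh1))]
  have ht2 : ∑ q ∈ Finset.range (M₂ + 1), (if q = h₂ then 0 else μ₂ q) = 1 - μ₂ h₂ := by
    have e : ∀ k ∈ Finset.range (M₂ + 1), (if k = h₂ then (0 : ℝ) else μ₂ k) = μ₂ k - (if k = h₂ then μ₂ k else 0) := by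
      intro k _; split_ifs with hk
      · rw [hk]; ring
      · ring
    rw [Finset.sum_congr rfl e, Finset.sum_sub_distrib, h21, Finset.sum_ite_eq' (Finset.range (M₂ + 1)) h₂,
      if_pos (Finset.mem_range.2 (Nat.lt_succ_of_le hh2))]
  -- (2) cells: a low cell charges neither head
  have hcell : ∀ i q, i + q ≤ j → 2 * ((i + q : ℕ) : ℝ) < T₁ + T₂ → (i = h₁ ∨ q = h₂) → μ₁ i * μ₂ q = 0 := by
    intro i q hle hlow hhd
    by_cases hμ1 : μ₁ i = 0
    · rw [hμ1, zero_mul]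
    by_cases hμ2 : μ₂ q = 0
    · rw [hμ2, mul_zero]
    exfalso
    rcases hhd with hi | hq
    · subst hi
      by_cases hq : q = h₂
      · subst hq; omega
      · have := hcross1 q hμ2 hq hle; linarith
    · subst hq
      by_cases hi : i = h₁
      · subst hi; omega
      · have := hcross2 i hμ1 hi hle; linarith
  have hlow := sum_low_lconv_le (T₁ + T₂) j M₁ M₂ h₁ h₂ μ₁ μ₂ h10 h20 hcell
  rw [ht1, ht2] at hlow
  have hgi := lconv_headCell_le_giants j M₁ M₂ h₁ h₂ μ₁ μ₂ h10 h20 hh1 hh2 hj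
  -- (3) criterion E for the convolution
  have hE : x * ∑ l ∈ Finset.range (j + 1), (if 2 * (l : ℝ) < T₁ + T₂ then lconv M₁ M₂ μ₁ μ₂ l else 0)
      ≤ (1 - x) * ∑ k ∈ Finset.Ico (j + 1) (M₁ + M₂ + 1), lconv M₁ M₂ μ₁ μ₂ k := by
    have h1x : 0 < 1 - x := by linarith
    have step1 : x * ∑ l ∈ Finset.range (j + 1), (if 2 * (l : ℝ) < T₁ + T₂ then lconv M₁ M₂ μ₁ μ₂ l else 0)
        ≤ x * ((1 - μ₁ h₁) * (1 - μ₂ h₂)) := mul_le_mul_of_nonneg_left hlow hx0.le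
    have step2 : x * ((1 - μ₁ h₁) * (1 - μ₂ h₂)) ≤ (1 - x) * (μ₁ h₁ * μ₂ h₂) := by
      have q1 : (1 - μ₁ h₁) * (1 - μ₂ h₂) ≤ (1 - x) * (1 - x) :=
        mul_le_mul (by linarith) (by linarith) (by linarith) (by linarith)
      have q2 : x * x ≤ μ₁ h₁ * μ₂ h₂ := mul_le_mul ha1 ha2 hx0.le (by linarith)
      have q3 : x * ((1 - x) * (1 - x)) ≤ (1 - x) * (x * x) := by
        have hp : 0 ≤ x * (1 - x) * (2 * x - 1) := mul_nonneg (mul_nonneg hx0.le (by linarith)) (by linarith)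
        have key : (1 - x) * (x * x) - x * ((1 - x) * (1 - x)) = x * (1 - x) * (2 * x - 1) := by ring
        linarith
      calc x * ((1 - μ₁ h₁) * (1 - μ₂ h₂)) ≤ x * ((1 - x) * (1 - x)) := mul_le_mul_of_nonneg_left q1 hx0.le
        _ ≤ (1 - x) * (x * x) := q3
        _ ≤ (1 - x) * (μ₁ h₁ * μ₂ h₂) := mul_le_mul_of_nonneg_left q2 h1x.le
    have step3 : (1 - x) * (μ₁ h₁ * μ₂ h₂) ≤ (1 - x) * ∑ k ∈ Finset.Ico (j + 1) (M₁ + M₂ + 1), lconv M₁ M₂ μ₁ μ₂ k :=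
      mul_le_mul_of_nonneg_left hgi h1x.le
    exact step1.trans (step2.trans step3)
  have hν0 : ∀ k, 0 ≤ lconv M₁ M₂ μ₁ μ₂ k := lconv_nonneg M₁ M₂ μ₁ μ₂ h10 h20
  exact (hdecAtT_of_hflowAtT x (T₁ + T₂) j (M₁ + M₂) _ hx0 hx1 (fun k hk => lconv_eq_zero M₁ M₂ μ₁ μ₂ k hk)
    (sum_lconv M₁ M₂ μ₁ μ₂ h11 h21) (hflowAtT_of_giantsAbsorbLows x (T₁ + T₂) j (M₁ + M₂) _ hx0 hx1 hν0 hE)).decAtT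

end LawDec

end Quant

end Summit.CriticalPhenomena.PercolationContinuityZ3.Theorems
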